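import Literature.IUT.HodgeArakelov.ThetaSettingHextOneElementAtModelTate
import HarnessLib

/-!
# `hextΔ` at the stage-2 Tate model: the ONE-ELEMENT CONJUGACY CRITERION
# (proof-only; K-L6 row «HEXT-DECIDE@modelχq», self-named sub-row «HEXT-ONE-ELEMENT@modelχq», file 2 of 2: the ★ criterion)

S. Mochizuki, *The étale theta function and its Frobenioid-theoretic manifestations* [EtTh], Publ. RIMS **45** (2009)
(refereed), §2, Prop. 2.4 p. 38 (every automorphism of `Π^tp_{X̲̲}` arises from one of `Π^tp_X`) [cite: MochizukiEtTh2009, Prop 2.4 p.38];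
§1 p. 12–13 (`Π^tp_X`, `Δ^tp_X`, the level coverings); Def. 2.5 (i) p. 39 (`X̲̲`).
Cell `abc-iut`, seat abc-iut-L6-d6 (gen 11).  PROOF-ONLY over file 1 (`ThetaSettingHextOneElementAtModelTate`:
`exists_gfpAut_extends_of_exists_conj`, `eq_top_of_dUU_le_of_gfpOf_zero_mem`) and abc-iut-L6-t13's ★ `hext_at_iff_exists_gfpAut_extends`;
NO definition, NO instance, NO new named fact; inputs BY NAME.  Setting and notation (`Γ`, `dUU l`, `a`, `γ̃`, (Δ)(γ), the clauses
`hinl`/`hinr`/`hleft`) as in file 1 and p497819.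

THE BINDER (displayed by p490266 / p491246 / p492265 / p493130 / p490639):
  `hextΔ(γ) : ∃ Γ : Π^tp_X ≃ₜ* Π^tp_X, Γ|_{Π^tp_{X̲̲}} = γ ∧ Γ(Δ^tp_X) = Δ^tp_X`     (`γ : Π^tp_{X̲̲} ≃ₜ* Π^tp_{X̲̲}`).

WHAT THIS FILE PROVES (EVERY prime `p`, EVERY `i j`, EVERY `X̲̲`-choice of the displayed shape, EVERY `l`).
* `map_deltaTemp_subgroupOf_Huu_eq_of_hext_at` — (Δ)(γ) ⟸ hextΔ(γ), for ONE `γ` (bookkeeping).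
* ★ `hext_at_iff_deltaTemp_and_exists_conj` — for ANY open normal `K ⊴ Γ` with `K ≤ dUU l`:
  **`hextΔ(γ) ⟺ (Δ)(γ) ∧ ∃ g ∈ Γ, ∀ n ∈ K, γ̃(a·n·a⁻¹) = g · γ̃(n) · g⁻¹`**; (⇒) with `g := Φ(a)`, (⇐) = file 1.
  In words: `γ` extends to `Π^tp_X` IF AND ONLY IF it transports «conjugation by the loop `a`» on the core `K` to an INNER automorphism
  of `Γ` — ONE element `g ∈ Γ` to be found (prover) or excluded (refuter), instead of an automorphism of the uncountable group `Γ`;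
  and since (⇐) holds for EVERY such `K`, the test may be run as deep in the level tower as convenient.
* ★ `hext_at_iff_deltaTemp_and_exists_conj_levelKer` — the same on the level-`l` core `N_l = Ker ĥ_l` (the normal core of `dUU l`
  in `Γ`); `…_levelKer_of_dvd` on `Ker ĥ_M` for any `l ∣ M` (`ker_levelHom_le_of_dvd`); `…_levelKer_of_eq` at the carrier of record
  `Huuχq p i j l hl` (the three membership clauses are theorems there).
CONSEQUENCE FOR THE K-L6 CELL (honest words): the question «`hextΔ` UNDECIDED-AT-MODEL» (p498683 + abc-iut-L6-t13 ★: an automorphism-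
extension problem `dUU l ≤ Γ`) is now: «given (Δ)(γ), does SOME `g ∈ Γ` conjugate like `a` under transport by `γ̃` on `Ker ĥ_l`?» —
equivalently, `γ̃` normalises the image of `Γ` in the abstract commensurator of `dUU l`.  A SHARPER EXACT REDUCTION, same species as the
instruments of record ((K1) p496371 all-extend families; R5-1 p496682/p497023 level-kernel test); neither direction of `hextΔ` is
claimed; `hextΔ` stays UNDECIDED-AT-MODEL.

HONEST LABEL. `modelχq` is a SEMI-SYNTHETIC model of the typed [EtTh] §1 interface (not the tempered `π₁` of a curve): a
statement about OUR model and OUR typed binder only; nothing of [EtTh] / [IUTchII] (claim key `Mochizuki2012`, DISPUTED, D-0012)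
is asserted; no side is taken on [IUTchIII] Cor. 3.12; typed ≠ proved; nothing here bears on whether abc is proved or refuted.
bears_on: LADDER-ABC:A2.L-K (K-L6 «HEXT-DECIDE@modelχq») → LADDER-FRONTIER F-A2 (M·L6) → rung 0 `Summit.ABC`.
-/

set_option autoImplicit false

noncomputable section

namespace Literature.AnabelianGeometry.EtaleTheta.SettingModel

open Literature.AnabelianGeometry.SemiGraphs
open Literature.IUT.HodgeArakelov Literature.IUT.HodgeArakelov.EtaleThetaDataOfSetting
open Function
open _root_.Topology
open scoped commutatorElement

/-! ## §0. Deeper level cores `Ker ĥ_M ≤ Ker ĥ_l` for `l ∣ M` -/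

/-- The level cores are antitone: `Ker ĥ_N ≤ Ker ĥ_M` for `M ∣ N` (`ĥ_M = (mod M) ∘ ĥ_N`). [cite: MochizukiEtTh2009, §1 p.13] -/
theorem ker_levelHom_le_of_dvd {M N : ℕ+} (h : (M : ℕ) ∣ N) : (levelHom N).ker ≤ (levelHom M).ker := fun g hg => by
  rw [MonoidHom.mem_ker] at hg ⊢
  have e := map_hHat_of_dvd h (g : F₂hatT × Multiplicative ℤ).1
  change Heis.map _ (levelHom N g) = levelHom M g at e
  rw [← e, hg, map_one]

variable {p : ℕ} [Fact p.Prime] {i j : ℤ} {hj : Even j} {E : (ThetaSetting.modelχq p i j hj).EtaleThetaData} {l : ℕ}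
  (C : E.DoubleUnderline l) {l' : ℕ+}
  (hinl : ∀ d ∈ dUU l', (SemidirectProduct.inl d : PiTpχq p i j) ∈ C.Huu)
  (hinr : ∀ σ : GQp p, (SemidirectProduct.inr σ : PiTpχq p i j) ∈ C.Huu)
  (hleft : ∀ h ∈ C.Huu, (h : PiTpχq p i j).left ∈ dUU l')

/-! ## §1. ★ The one-element criterion: `hextΔ(γ) ⟺ (Δ)(γ) ∧ ∃ g ∈ Γ, ∀ n ∈ K, γ̃(a n a⁻¹) = g γ̃(n) g⁻¹` -/

/-- **(Δ)(γ) ⟸ hextΔ(γ)** (per `γ`): if `γ` extends to a `Δ^tp_X`-stabilising bi-continuous automorphism of `Π^tp_X`, then `γ`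
maps `Δ^tp_X ∩ Π^tp_{X̲̲}` onto itself (the shape of abc-iut-L6-d6 gen 5's `map_deltaTemp_subgroupOf_Huu_eq_of_extends`, for ONE `γ`).
[cite: MochizukiEtTh2009, Prop 2.4 p.38] -/
theorem map_deltaTemp_subgroupOf_Huu_eq_of_hext_at (γ : ↥C.Huu ≃ₜ* ↥C.Huu)
    (hγ : ∃ Γ : PiTpχq p i j ≃ₜ* PiTpχq p i j,
      (∀ h : C.Huu, Γ (h : PiTpχq p i j) = ((γ h : C.Huu) : PiTpχq p i j)) ∧
        (curveχq p i j).DeltaTemp.map Γ.toMulEquiv.toMonoidHom = (curveχq p i j).DeltaTemp) :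
    ((curveχq p i j).DeltaTemp.subgroupOf C.Huu).map γ.toMulEquiv.toMonoidHom =
      (curveχq p i j).DeltaTemp.subgroupOf C.Huu := by
  obtain ⟨Γ, hΓ, hΔ⟩ := hγ
  -- `Γ⁻¹` also stabilises `Δ^tp_X`
  have hΔ' : ∀ x : PiTpχq p i j, x ∈ (curveχq p i j).DeltaTemp → Γ.symm x ∈ (curveχq p i j).DeltaTemp := by
    intro x hx
    rw [← hΔ] at hx
    obtain ⟨y, hy, hyx⟩ := hx
    have : Γ.symm x = y := by rw [← hyx]; exact Γ.symm_apply_apply y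
    rw [this]
    exact hy
  ext h
  simp only [Subgroup.mem_map, Subgroup.mem_subgroupOf]
  constructor
  · rintro ⟨h₀, hh₀, rfl⟩
    change ((γ h₀ : C.Huu) : PiTpχq p i j) ∈ (curveχq p i j).DeltaTemp
    rw [← hΓ h₀, ← hΔ]
    exact ⟨(h₀ : PiTpχq p i j), hh₀, rfl⟩
  · intro hh
    refine ⟨γ.symm h, ?_, γ.apply_symm_apply h⟩
    have e : ((γ.symm h : C.Huu) : PiTpχq p i j) = Γ.symm (h : PiTpχq p i j) := by
      apply Γ.injective
      rw [Γ.apply_symm_apply, hΓ (γ.symm h), γ.apply_symm_apply]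
    rw [e]
    exact hΔ' _ hh

include hinl hinr hleft in
/-- ★ **THE ONE-ELEMENT CRITERION (any open normal `K ≤ dUU l` of `Γ`).**  At an `X̲̲`-choice with `Π^tp_{X̲̲} = dUU l ⋊ G_{ℚ_p}`
over the stage-2 Tate model, a bi-continuous automorphism `γ` of `Π^tp_{X̲̲}` extends to a `Δ^tp_X`-stabilising bi-continuous
automorphism of `Π^tp_X` (`hextΔ(γ)`) **if and only if** (Δ)(γ) [`γ` maps `Δ^tp_X ∩ Π^tp_{X̲̲}` onto itself — a THEOREM at the Tate
record, p488629/p498716] **and there is ONE element `g ∈ Γ` with `γ̃(a·n·a⁻¹) = g · γ̃(n) · g⁻¹` for every `n ∈ K`** (`γ̃ d :=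
(γ (inl d)).left`, `a = gfpOf (of 0)` the tempered loop): `γ` must transport conjugation-by-`a` on `K` to an INNER automorphism of `Γ`
— and then `g = Φ(a)` for the unique extension `Φ`.  Since (⇐) holds for EVERY such `K`, the criterion may be tested as deep in the
level tower `Ker ĥ_{lM}` as convenient.  Neither direction of `hextΔ` is claimed. [cite: MochizukiEtTh2009, Prop 2.4 p.38] -/
theorem hext_at_iff_deltaTemp_and_exists_conj (K : Subgroup Gfp) (hKn : K.Normal) (hKo : IsOpen (K : Set Gfp))
    (hKU : K ≤ dUU l') (γ : ↥C.Huu ≃ₜ* ↥C.Huu) :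
    (∃ Γ : PiTpχq p i j ≃ₜ* PiTpχq p i j,
      (∀ h : C.Huu, Γ (h : PiTpχq p i j) = ((γ h : C.Huu) : PiTpχq p i j)) ∧
        (curveχq p i j).DeltaTemp.map Γ.toMulEquiv.toMonoidHom = (curveχq p i j).DeltaTemp) ↔
    ((curveχq p i j).DeltaTemp.subgroupOf C.Huu).map γ.toMulEquiv.toMonoidHom =
        (curveχq p i j).DeltaTemp.subgroupOf C.Huu ∧
      ∃ g : Gfp, ∀ (n : Gfp) (hn : n ∈ K),
        ((γ ⟨SemidirectProduct.inl (gfpOf (FreeGroup.of 0) * n * (gfpOf (FreeGroup.of 0))⁻¹),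
            hinl _ (hKU (hKn.conj_mem n hn _))⟩ : C.Huu) : PiTpχq p i j).left =
          g * ((γ ⟨SemidirectProduct.inl n, hinl n (hKU hn)⟩ : C.Huu) : PiTpχq p i j).left * g⁻¹ := by
  constructor
  · intro hγ
    refine ⟨map_deltaTemp_subgroupOf_Huu_eq_of_hext_at C γ hγ, ?_⟩
    obtain ⟨Φ, hΦ⟩ := (hext_at_iff_exists_gfpAut_extends C hinl hinr hleft γ).mp hγ
    refine ⟨Φ (gfpOf (FreeGroup.of 0)), fun n hn => ?_⟩
    have e1 := congrArg SemidirectProduct.left (hΦ _ (hKU (hKn.conj_mem n hn (gfpOf (FreeGroup.of 0)))))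
    have e2 := congrArg SemidirectProduct.left (hΦ n (hKU hn))
    rw [SemidirectProduct.left_inl] at e1 e2
    rw [← e1, ← e2, map_mul, map_mul, map_inv]
  · rintro ⟨hΔγ, g, hg⟩
    obtain ⟨Φ, -, hΦ⟩ := exists_gfpAut_extends_of_exists_conj C hinl hleft K hKn hKo hKU γ hΔγ g hg
    exact (hext_at_iff_exists_gfpAut_extends C hinl hinr hleft γ).mpr ⟨Φ, hΦ⟩

include hinl hinr hleft in
/-- ★ **THE ONE-ELEMENT CRITERION ON THE LEVEL-`l` CORE `N_l = Ker ĥ_l`** (the normal core of `dUU l` in `Γ`):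
`hextΔ(γ) ⟺ (Δ)(γ) ∧ ∃ g ∈ Γ, ∀ n ∈ N_l, γ̃(a n a⁻¹) = g · γ̃(n) · g⁻¹`. [cite: MochizukiEtTh2009, Prop 2.4 p.38] -/
theorem hext_at_iff_deltaTemp_and_exists_conj_levelKer (γ : ↥C.Huu ≃ₜ* ↥C.Huu) :
    (∃ Γ : PiTpχq p i j ≃ₜ* PiTpχq p i j,
      (∀ h : C.Huu, Γ (h : PiTpχq p i j) = ((γ h : C.Huu) : PiTpχq p i j)) ∧
        (curveχq p i j).DeltaTemp.map Γ.toMulEquiv.toMonoidHom = (curveχq p i j).DeltaTemp) ↔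
    ((curveχq p i j).DeltaTemp.subgroupOf C.Huu).map γ.toMulEquiv.toMonoidHom =
        (curveχq p i j).DeltaTemp.subgroupOf C.Huu ∧
      ∃ g : Gfp, ∀ (n : Gfp) (hn : n ∈ (levelHom l').ker),
        ((γ ⟨SemidirectProduct.inl (gfpOf (FreeGroup.of 0) * n * (gfpOf (FreeGroup.of 0))⁻¹),
            hinl _ (ker_levelHom_le_dUU l' ((MonoidHom.normal_ker (levelHom l')).conj_mem n hn _))⟩ : C.Huu) :
              PiTpχq p i j).left =
          g * ((γ ⟨SemidirectProduct.inl n, hinl n (ker_levelHom_le_dUU l' hn)⟩ : C.Huu) : PiTpχq p i j).left * g⁻¹ :=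
  hext_at_iff_deltaTemp_and_exists_conj C hinl hinr hleft (levelHom l').ker (MonoidHom.normal_ker _)
    (isOpen_ker_levelHom l') (ker_levelHom_le_dUU l') γ

include hinl hinr hleft in
/-- ★ **The one-element criterion on a DEEPER level core `Ker ĥ_M`, any `l ∣ M`** (`Ker ĥ_M ⊴ Γ` open, `≤ Ker ĥ_l ≤ dUU l`):
`hextΔ(γ) ⟺ (Δ)(γ) ∧ ∃ g ∈ Γ, ∀ n ∈ Ker ĥ_M, γ̃(a n a⁻¹) = g · γ̃(n) · g⁻¹` — the refuter's test may be run at any depth of the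
level tower. [cite: MochizukiEtTh2009, Prop 2.4 p.38] -/
theorem hext_at_iff_deltaTemp_and_exists_conj_levelKer_of_dvd (M : ℕ+) (hM : (l' : ℕ) ∣ M) (γ : ↥C.Huu ≃ₜ* ↥C.Huu) :
    (∃ Γ : PiTpχq p i j ≃ₜ* PiTpχq p i j,
      (∀ h : C.Huu, Γ (h : PiTpχq p i j) = ((γ h : C.Huu) : PiTpχq p i j)) ∧
        (curveχq p i j).DeltaTemp.map Γ.toMulEquiv.toMonoidHom = (curveχq p i j).DeltaTemp) ↔
    ((curveχq p i j).DeltaTemp.subgroupOf C.Huu).map γ.toMulEquiv.toMonoidHom =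
        (curveχq p i j).DeltaTemp.subgroupOf C.Huu ∧
      ∃ g : Gfp, ∀ (n : Gfp) (hn : n ∈ (levelHom M).ker),
        ((γ ⟨SemidirectProduct.inl (gfpOf (FreeGroup.of 0) * n * (gfpOf (FreeGroup.of 0))⁻¹),
            hinl _ (ker_levelHom_le_dUU l' (ker_levelHom_le_of_dvd hM
              ((MonoidHom.normal_ker (levelHom M)).conj_mem n hn _)))⟩ : C.Huu) : PiTpχq p i j).left =
          g * ((γ ⟨SemidirectProduct.inl n, hinl n (ker_levelHom_le_dUU l' (ker_levelHom_le_of_dvd hM hn))⟩ : C.Huu) :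
            PiTpχq p i j).left * g⁻¹ :=
  hext_at_iff_deltaTemp_and_exists_conj C hinl hinr hleft (levelHom M).ker (MonoidHom.normal_ker _)
    (isOpen_ker_levelHom M) (fun _ hn => ker_levelHom_le_dUU l' (ker_levelHom_le_of_dvd hM hn)) γ

/-- ★ **The one-element criterion AT THE CARRIER OF RECORD** `Π^tp_{X̲̲} = Huuχq p i j l hl` (the three membership clauses are
theorems there): for every `X̲̲`-choice `C` over `modelχq p i j` with `C.Huu = Huuχq p i j l hl`,
`hextΔ(γ) ⟺ (Δ)(γ) ∧ ∃ g ∈ Γ, ∀ n ∈ Ker ĥ_l, γ̃(a n a⁻¹) = g γ̃(n) g⁻¹`. [cite: MochizukiEtTh2009, Prop 2.4 p.38] -/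
theorem hext_at_iff_deltaTemp_and_exists_conj_levelKer_of_eq (l' : ℕ+) (hl' : Odd (l' : ℕ))
    (hCH : C.Huu = Huuχq p i j l' hl') (γ : ↥C.Huu ≃ₜ* ↥C.Huu) :
    (∃ Γ : PiTpχq p i j ≃ₜ* PiTpχq p i j,
      (∀ h : C.Huu, Γ (h : PiTpχq p i j) = ((γ h : C.Huu) : PiTpχq p i j)) ∧
        (curveχq p i j).DeltaTemp.map Γ.toMulEquiv.toMonoidHom = (curveχq p i j).DeltaTemp) ↔
    ((curveχq p i j).DeltaTemp.subgroupOf C.Huu).map γ.toMulEquiv.toMonoidHom =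
        (curveχq p i j).DeltaTemp.subgroupOf C.Huu ∧
      ∃ g : Gfp, ∀ (n : Gfp) (hn : n ∈ (levelHom l').ker),
        ((γ ⟨SemidirectProduct.inl (gfpOf (FreeGroup.of 0) * n * (gfpOf (FreeGroup.of 0))⁻¹),
            hCH ▸ (inl_mem_Huuχq_iff p i j l' hl' _).2
              (ker_levelHom_le_dUU l' ((MonoidHom.normal_ker (levelHom l')).conj_mem n hn _))⟩ : C.Huu) :
              PiTpχq p i j).left =
          g * ((γ ⟨SemidirectProduct.inl n, hCH ▸ (inl_mem_Huuχq_iff p i j l' hl' n).2 (ker_levelHom_le_dUU l' hn)⟩ :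
            C.Huu) : PiTpχq p i j).left * g⁻¹ :=
  hext_at_iff_deltaTemp_and_exists_conj_levelKer C (fun d hd => hCH ▸ (inl_mem_Huuχq_iff p i j l' hl' d).2 hd)
    (fun σ => hCH ▸ inr_mem_Huuχq p i j l' hl' σ)
    (fun h hh => ((mem_Huuχq_iff p i j l' hl' h).1 (hCH ▸ hh)).1 |> fun hx =>
      (mem_dUU_iff l' h.left).2 ⟨hx, ((mem_Huuχq_iff p i j l' hl' h).1 (hCH ▸ hh)).2⟩) γ

end Literature.AnabelianGeometry.EtaleTheta.SettingModel

end
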